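import Literature.Probability.Percolation.PortLink
import HarnessLib

/-!
# The port-level bits are the crossing events of the link quads

Topic `Probability/Percolation`.  Support file (proofs, no named fact) for step (C) of the proof
of Schramm–Smirnov's Prop. 4.1 (Ann. Probab. 39 (2011), §4: "v, v' ∈ Z_o are connected by an
edge in G* if the two corresponding beaches are connected by an open crossing in ω̃|([Q₀]∖M)").
For a traced loop based so that the port of the first hub contact is the final arc `[a₃, P)` and
the port of the second is the arc `[a₁, a₂)` (both maximal open stretches: the flanking sides
`0, a₁ - 1, a₂, a₃ - 1` are not open), the port-level bit `PortBit i j` of `PortLink.lean`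
coincides with the crossing event of the link quad with these two arcs marked
(`portBit_iff_linkQuad_mem`, from `Ports.mem_z2QuadConfig_linkQuad_iff_docking`).  The confinement
of open stretches between closed sides (`mod_mem_Ico_of_samePort`) identifies "same port" with the
arcs.

## References

* O. Schramm, S. Smirnov, *On the scaling limits of planar percolation*, Ann. Probab. 39 (2011)
  1768–1814, arXiv:1101.5820, §4, proof of Prop. 4.1 (the graph G*). [SchrammSmirnov2011]
-/

noncomputable section

open Set Relation
open Literature.Probability.LatticeModels
open scoped Classical

namespace Literature.Probability.Percolation

namespace CellComplex

namespace TileData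

open QuadCrossing

variable {𝒯 : TileData} {d₀ : Site 2 × Fin 4}

/-! ### Periodicity -/

/-- Open sides are periodic. [folklore] -/
theorem isOpenSide_add_mul_period (h₀ : IsBd 𝒯.U d₀) (i q : ℕ) :
    𝒯.IsOpenSide d₀ (i + q * period h₀) ↔ 𝒯.IsOpenSide d₀ i := by
  simp only [IsOpenSide, TileData.hubContact, outCell_add_mul_period h₀]

/-- Open sides only depend on the index modulo the period. [folklore] -/
theorem isOpenSide_mod (h₀ : IsBd 𝒯.U d₀) (i : ℕ) : 𝒯.IsOpenSide d₀ (i % period h₀) ↔ 𝒯.IsOpenSide d₀ i := by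
  conv_rhs => rw [← Nat.mod_add_div' i (period h₀)]
  exact (isOpenSide_add_mul_period h₀ _ _).symm

/-- The edge segment of a side only depends on the index modulo the period. [folklore] -/
theorem edgeSeg_mod (h₀ : IsBd 𝒯.U d₀) (i : ℕ) :
    edgeSeg (vert 𝒯.U d₀ (i % period h₀)) (dirAt 𝒯.U d₀ (i % period h₀)) = edgeSeg (vert 𝒯.U d₀ i) (dirAt 𝒯.U d₀ i) := by
  simp only [vert, dirAt, bdOrbit_mod h₀]

/-! ### Confinement of open stretches between closed sides -/

/-- **An open stretch does not pass a closed side**: if all sides of `[lo, hi]` are open, `x ∈ [lo, hi]`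
and the sides `c₁ ≤ x ≤ c₂`… more precisely if `c₁ < x < c₂` are not open then `[lo, hi] ⊆ (c₁, c₂)`.
[folklore] -/
theorem Icc_subset_of_open {lo hi x c₁ c₂ : ℕ} (hopen : ∀ l, lo ≤ l → l ≤ hi → 𝒯.IsOpenSide d₀ l)
    (hx : lo ≤ x ∧ x ≤ hi) (hc₁ : c₁ < x) (hc₂ : x < c₂) (h₁ : ¬ 𝒯.IsOpenSide d₀ c₁) (h₂ : ¬ 𝒯.IsOpenSide d₀ c₂) :
    ∀ y, lo ≤ y → y ≤ hi → c₁ < y ∧ y < c₂ := by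
  intro y hy1 hy2
  constructor
  · by_contra h
    exact h₁ (hopen c₁ (by omega) (by omega))
  · by_contra h
    exact h₂ (hopen c₂ (by omega) (by omega))

/-- Reduction modulo `P` inside the window `[aP, aP + P)`. [folklore] -/
theorem mod_eq_sub_of_window {v a P : ℕ} (h1 : a * P ≤ v) (h2 : v < a * P + P) : v % P = v - a * P := by
  have e : v = (v - a * P) + a * P := (Nat.sub_add_cancel h1).symm
  conv_lhs => rw [e]
  rw [Nat.add_mul_mod_self_right]
  exact Nat.mod_eq_of_lt (by omega)

/-- **Same port as a contact of the final arc**: if the sides `a₃ - 1` and `0` are not open and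
`i ∈ [a₃, P)`, every index in the same port as `i` reduces modulo `P` into `[a₃, P)`. [folklore] -/
theorem mod_mem_Ico_of_samePort (h₀ : IsBd 𝒯.U d₀) {a₃ i i' : ℕ} (ha₃ : 1 ≤ a₃) (hi : a₃ ≤ i ∧ i < period h₀)
    (hc : ¬ 𝒯.IsOpenSide d₀ (a₃ - 1)) (hc0 : ¬ 𝒯.IsOpenSide d₀ 0) (hsame : 𝒯.SamePort d₀ h₀ i i') :
    a₃ ≤ i' % period h₀ ∧ i' % period h₀ < period h₀ := by
  obtain ⟨a, b, lo, hi', h1, h2, h3, h4, hopen⟩ := hsame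
  have hP0 : 0 < period h₀ := period_pos h₀
  -- the closed sides around the copy of the arc containing `i + a P`
  have hc₁ : ¬ 𝒯.IsOpenSide d₀ (a₃ - 1 + a * period h₀) := by rwa [isOpenSide_add_mul_period h₀]
  have hc₂ : ¬ 𝒯.IsOpenSide d₀ (a * period h₀ + period h₀) := by
    rw [show a * period h₀ + period h₀ = 0 + (a + 1) * period h₀ by ring, isOpenSide_add_mul_period h₀]; exact hc0
  have hconf := Icc_subset_of_open hopen ⟨h1, h2⟩ (by omega) (by omega) hc₁ hc₂ (i' + b * period h₀) h3 h4
  have hmod : (i' + b * period h₀) % period h₀ = i' % period h₀ := Nat.add_mul_mod_self_right i' b (period h₀)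
  rw [← hmod, mod_eq_sub_of_window (a := a) (by omega) hconf.2]
  omega

/-- **Same port as a contact of a middle arc**: if the sides `a₁ - 1` and `a₂` are not open and
`j ∈ [a₁, a₂)`, every index in the same port as `j` reduces modulo `P` into `[a₁, a₂)`. [folklore] -/
theorem mod_mem_Ico_of_samePort' (h₀ : IsBd 𝒯.U d₀) {a₁ a₂ j j' : ℕ} (ha₁ : 1 ≤ a₁) (ha₂ : a₂ < period h₀)
    (hj : a₁ ≤ j ∧ j < a₂) (hc₁ : ¬ 𝒯.IsOpenSide d₀ (a₁ - 1)) (hc₂ : ¬ 𝒯.IsOpenSide d₀ a₂) (hsame : 𝒯.SamePort d₀ h₀ j j') :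
    a₁ ≤ j' % period h₀ ∧ j' % period h₀ < a₂ := by
  obtain ⟨a, b, lo, hi', h1, h2, h3, h4, hopen⟩ := hsame
  have hP0 : 0 < period h₀ := period_pos h₀
  have hc₁' : ¬ 𝒯.IsOpenSide d₀ (a₁ - 1 + a * period h₀) := by rwa [isOpenSide_add_mul_period h₀]
  have hc₂' : ¬ 𝒯.IsOpenSide d₀ (a₂ + a * period h₀) := by rwa [isOpenSide_add_mul_period h₀]
  have hconf := Icc_subset_of_open hopen ⟨h1, h2⟩ (by omega) (by omega) hc₁' hc₂' (j' + b * period h₀) h3 h4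
  have hmod : (j' + b * period h₀) % period h₀ = j' % period h₀ := Nat.add_mul_mod_self_right j' b (period h₀)
  rw [← hmod, mod_eq_sub_of_window (a := a) (by omega) (by omega)]
  omega

/-! ### The port-level bit is the crossing event of the link quad -/

section LinkQuad

variable {δ : ℝ} (hδ : 0 < δ) (h₀ : IsBd 𝒯.U d₀) (a : Fin 4 → ℕ) (ha0 : a 0 = 0) (hmono : StrictMono a)
  (ha3 : a 3 < period h₀) {D : Set ℂ} (hD : cellScale δ hδ '' Kset 𝒯.U ⊆ D) {η : BondConfig (Site 2)}
  (hcons : ∀ e ∈ 𝒯.clE, e ∉ η)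
  (hX : ∀ e ∈ (zdGraph 2).edgeSet, (∃ v ∈ e, v ∈ 𝒯.Wv) → (∃ u ∈ e, u ∉ 𝒯.Wv) → e ∈ 𝒯.hubE ∨ e ∈ 𝒯.clE)
  -- the two marked arcs are ports: open inside, not open at the flanking sides
  (hopen3 : ∀ l, a 3 ≤ l → l < period h₀ → 𝒯.IsOpenSide d₀ l)
  (hopen1 : ∀ l, a 1 ≤ l → l < a 2 → 𝒯.IsOpenSide d₀ l)
  (hcl0 : ¬ 𝒯.IsOpenSide d₀ 0) (hcl1 : ¬ 𝒯.IsOpenSide d₀ (a 1 - 1)) (hcl2 : ¬ 𝒯.IsOpenSide d₀ (a 2))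
  (hcl3 : ¬ 𝒯.IsOpenSide d₀ (a 3 - 1))
include hcons hX hopen3 hopen1 hcl0 hcl1 hcl2 hcl3 ha0

omit hopen3 hopen1 hcl0 hcl1 hcl2 hcl3 ha0 in
/-- Edges from accessible sites leaving the window are closed (they are examined, and not open
since the site is not a hub vertex). [folklore] -/
theorem not_mem_of_leaving (x : Site 2) (k : Fin 4) (hx : σc x ∈ 𝒯.U) (hk : x + cornerUnit k ∉ 𝒯.Wv) :
    dartEdge x k ∉ η := by
  obtain ⟨hxO, e, he, hxe⟩ := (σc_mem_U_iff 𝒯).1 hx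
  have hxW : x ∈ 𝒯.Wv := 𝒯.acc_window e he x hxe
  rcases hX _ (dartEdge_mem_edgeSet x k) ⟨x, mem_dartEdge_iff.2 (Or.inl rfl), hxW⟩
    ⟨_, mem_dartEdge_iff.2 (Or.inr rfl), hk⟩ with h | h
  · exact absurd (𝒯.hub_O _ h x (mem_dartEdge_iff.2 (Or.inl rfl))) hxO
  · exact hcons _ h

/-- **The port-level bit between a contact of the final arc and a contact of the middle arc is the
crossing event of the link quad.** [cite: SchrammSmirnov2011, §4, proof of Prop. 4.1 (edges of G*: "the two corresponding beaches are connected by an open crossing in ω̃|([Q₀]∖M)")] -/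
theorem portBit_iff_linkQuad_mem {i j : ℕ} (hi : a 3 ≤ i ∧ i < period h₀) (hj : a 1 ≤ j ∧ j < a 2)
    (hhi : 𝒯.hubContact d₀ i) (hhj : 𝒯.hubContact d₀ j) :
    𝒯.PortBit d₀ h₀ η i j ↔
      linkQuad hδ h₀ 𝒯.pinchFree 𝒯.edgeConn 𝒯.coHoleFree a hmono ha3 hD ∈ z2QuadConfig D δ η := by
  have ha1 : 1 ≤ a 1 := by have := hmono (show (0 : Fin 4) < 1 by decide); omega
  have ha12 : a 1 < a 2 := hmono (show (1 : Fin 4) < 2 by decide)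
  have ha23 : a 2 < a 3 := hmono (show (2 : Fin 4) < 3 by decide)
  have hP0 : 0 < period h₀ := period_pos h₀
  rw [𝒯.mem_z2QuadConfig_linkQuad_iff_docking hδ h₀ a ha0 hmono ha3 hD hcons (not_mem_of_leaving hcons hX)]
  constructor
  · rintro ⟨-, -, -, i', j', hii', hjj', x, k, x', k', ⟨hσ, hβ, hηx, hcpt⟩, ⟨hσ', hβ', hηx', hcpt'⟩, hpath⟩
    refine ⟨x, k, x', k', hηx, hηx', hσ, hβ, hσ', hβ', ⟨i' % period h₀, ?_, ?_, ?_⟩, ⟨j' % period h₀, ?_, ?_, ?_⟩, hpath⟩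
    · exact (mod_mem_Ico_of_samePort h₀ (by omega) hi hcl3 hcl0 hii').1
    · exact Nat.mod_lt _ hP0
    · rwa [edgeSeg_mod h₀]
    · exact (mod_mem_Ico_of_samePort' h₀ ha1 (ha23.trans ha3) hj hcl1 hcl2 hjj').1
    · exact (mod_mem_Ico_of_samePort' h₀ ha1 (ha23.trans ha3) hj hcl1 hcl2 hjj').2
    · rwa [edgeSeg_mod h₀]
  · rintro ⟨x, k, x', k', hηx, hηx', hσ, hβ, hσ', hβ', ⟨l, hl1, hl2, hcpt⟩, ⟨l', hl1', hl2', hcpt'⟩, hpath⟩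
    have hhl : 𝒯.hubContact d₀ l := (𝒯.hubContact_of_docking h₀ (mem_O_of_dock hσ hβ) hβ hcpt).2.1
    have hhl' : 𝒯.hubContact d₀ l' := (𝒯.hubContact_of_docking h₀ (mem_O_of_dock hσ' hβ') hβ' hcpt').2.1
    -- `i` and `l` lie in the final arc, `j` and `l'` in the middle arc: same ports
    have hsame : 𝒯.SamePort d₀ h₀ i l :=
      ⟨0, 0, a 3, period h₀ - 1, by omega, by omega, by omega, by omega, fun m hm1 hm2 => hopen3 m hm1 (by omega)⟩
    have hsame' : 𝒯.SamePort d₀ h₀ j l' :=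
      ⟨0, 0, a 1, a 2 - 1, by omega, by omega, by omega, by omega, fun m hm1 hm2 => hopen1 m hm1 (by omega)⟩
    -- different ports: an open stretch containing `i` and `j` would contain the closed side `a 3 - 1`
    have hdiff : ¬ 𝒯.SamePort d₀ h₀ i j := by
      intro h
      have := mod_mem_Ico_of_samePort h₀ (by omega) hi hcl3 hcl0 h
      rw [Nat.mod_eq_of_lt (by omega : j < period h₀)] at this
      omega
    exact ⟨hhi, hhj, hdiff, l, l', hsame, hsame', x, k, x', k', ⟨hσ, hβ, hηx, hcpt⟩, ⟨hσ', hβ', hηx', hcpt'⟩, hpath⟩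

end LinkQuad

end TileData

end CellComplex

end Literature.Probability.Percolation

end
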